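/-
HONEST FRAMING: certified error envelopes and provably optimal rounding/accumulation schemes for
low-precision formats under stated cost models; every table by two implementations; no hardware
or vendor claims.
-/
import Summits.Ventures.CertifiedArithmetic.LowPrec.OptDemotionRoutingValue
import Summits.Ventures.CertifiedArithmetic.LowPrec.OptDemotionRoutingLRL

/-!
# The demotion law (Theorem T8), part 8m: the UN-CARRY DESCENT from top-of-window pairs (opt gen 13 (UC-II′), R20(a))

A TOP PAIR at budget `m ∈ [2^(q-1), 2^q)` is `(o, e) = (n + ½, m - n)` with `n < 2^(q-1)`: two
`q`-bit floats summing to `m + ½` (the parent's value plus the half ulp), the odd one `o` holding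
the half-ulp bit.  THIS FILE proves, from opt's two-tree inequality `TT q` (part 8l) together with
the PROVED monotonicity/midpoint-convexity facts, that no top pair beats the best bit partition:
`2^(q-1) + BR_a(n + ½) + BR_b(m - n) ≤ BR_(a·b)(bits m)` (`topPair_le_of_TT`, both orientations),
by strong induction on the total number of bits of `n` and `m - n` (opt's popcount descent): a
common bit `2^k` of `n` and `m - n` is un-carried by one of the sum-preserving moves
`M1 = (n + 2^k | m - n - 2^k)`, `M2 = (n - 2^k | m - n + 2^k)` (weakly improving by (MC) twice,
part 8l, when `n + 2^k < 2^(q-1)`) or `M1′ = (m - n - 2^k odd | n + 2^k)`, `M2` (weakly improving by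
`TT`, when `n + 2^k ≥ 2^(q-1)`, which forces `m - n < 2^(q-1)`); with no common bit the pair IS a
bit partition of `bits m ∪ {-1}` (`val_union_of_disjoint`, uniqueness of binary expansions).
Part 8n raises arbitrary admissible pairs to top pairs ((M), part 8i) and concludes `LRL q`, hence
Conjecture D for every tree, from `TT q`.
-/

namespace Summit.Ventures.CertifiedArithmetic.LowPrec.Opt

open Literature.ComputerArithmetic.JeannerodRump2018
open Literature.ComputerArithmetic.JeannerodRump2018.SumTree

/-! ## Bits of naturals, halves, carries -/

/-- `(k : ℤ) ∈ natBits n ↔ bit k of n is set`. -/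
theorem natCast_mem_natBits {n k : ℕ} : (k : ℤ) ∈ natBits n ↔ n.testBit k = true := by
  rw [mem_natBits]
  constructor
  · rintro ⟨i, hi, h⟩
    have : i = k := by exact_mod_cast h
    rw [← this]; exact hi
  · intro h; exact ⟨k, h, rfl⟩

/-- Elements of `natBits` are nonnegative. -/
theorem natBits_nonneg {n : ℕ} {e : ℤ} (he : e ∈ natBits n) : 0 ≤ e := by
  obtain ⟨i, -, rfl⟩ := mem_natBits.1 he; positivity

/-- `bitsOf n = natBits n`. -/
theorem bitsOf_natCast (n : ℕ) : bitsOf (n : ℚ) = natBits n := by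
  rw [← val_natBits n, bitsOf_val]

/-- `natBits n ≠ ∅` for `n ≥ 1`. -/
theorem natBits_nonempty {n : ℕ} (hn : 1 ≤ n) : (natBits n).Nonempty := by
  by_contra h
  rw [Finset.not_nonempty_iff_eq_empty] at h
  have := val_natBits n
  rw [h, val_empty] at this
  have : (1 : ℚ) ≤ n := by exact_mod_cast hn
  linarith

/-- A positive integer below `2^q` is a `q`-bit float. -/
theorem isQFloat_natCast {q n : ℕ} (hn : 1 ≤ n) (hn' : n < 2 ^ q) : IsQFloat q (n : ℚ) :=
  ⟨natBits n, natBits_nonempty hn, natBits_routable hn', val_natBits n⟩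

/-- The half configuration of `n`: `bits n ∪ {-1}` is worth `n + ½`. -/
theorem val_insert_neg_one (n : ℕ) : val (insert (-1 : ℤ) (natBits n)) = (n : ℚ) + 1 / 2 := by
  have h : (-1 : ℤ) ∉ natBits n := fun h => by have := natBits_nonneg h; omega
  rw [val_insert h, val_natBits, zpow_neg, zpow_one]; ring

/-- `bitsOf (n + ½) = bits n ∪ {-1}`. -/
theorem bitsOf_half (n : ℕ) : bitsOf ((n : ℚ) + 1 / 2) = insert (-1 : ℤ) (natBits n) := by
  rw [← val_insert_neg_one n, bitsOf_val]

/-- `n + ½` is a `q`-bit float for `n < 2^(q-1)` (`q ≥ 1`). -/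
theorem isQFloat_half {q n : ℕ} (hq : 1 ≤ q) (hn : n < 2 ^ (q - 1)) : IsQFloat q ((n : ℚ) + 1 / 2) := by
  refine ⟨insert (-1 : ℤ) (natBits n), Finset.insert_nonempty _ _, ?_, val_insert_neg_one n⟩
  have hb : ∀ e ∈ insert (-1 : ℤ) (natBits n), -1 ≤ e ∧ e < (q : ℤ) - 1 := by
    intro e he
    rcases Finset.mem_insert.1 he with rfl | he
    · constructor
      · exact le_rfl
      · have : (1 : ℤ) ≤ q := by exact_mod_cast hq
        linarith
    · obtain ⟨h0, hlt⟩ := natBits_lt hn he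
      constructor
      · linarith
      · have : ((q - 1 : ℕ) : ℤ) = (q : ℤ) - 1 := by push_cast [Nat.cast_sub hq]; ring
        rw [this] at hlt; exact hlt
  intro x hx y hy
  have h1 := hb x hx; have h2 := hb y hy
  linarith [h1.2, h2.1]

/-- Removing a set bit: `bits (n - 2^k) = bits n ∖ {k}`. -/
theorem natBits_sub_pow {n k : ℕ} (h : n.testBit k = true) : natBits (n - 2 ^ k) = (natBits n).erase k := by
  have hk : (k : ℤ) ∈ natBits n := natCast_mem_natBits.2 h
  have hle : 2 ^ k ≤ n := Nat.ge_two_pow_of_testBit h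
  apply eq_of_val_eq
  rw [val_natBits]
  have := val_eq_add_erase hk
  rw [val_natBits] at this
  push_cast [Nat.cast_sub hle]
  rw [zpow_natCast] at this
  linarith

/-- The carry: adding a set bit `2^k` never increases the number of bits, and the new value has a
binary expansion. -/
theorem card_natBits_add_pow_le {n k : ℕ} (h : n.testBit k = true) :
    (natBits (n + 2 ^ k)).card ≤ (natBits n).card := by
  classical
  set S := natBits n with hS
  have hk : (k : ℤ) ∈ S := natCast_mem_natBits.2 h
  -- the maximal run of set bits from k
  have hne : S.Nonempty := ⟨_, hk⟩
  have hex : ∃ j : ℕ, (k : ℤ) + ((j : ℤ) + 1) ∉ S := by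
    refine ⟨(S.max' hne - k).toNat, fun h' => ?_⟩
    have h1 := Finset.le_max' S _ h'
    have h2 : (k : ℤ) ≤ S.max' hne := Finset.le_max' S _ hk
    have h3 : (((S.max' hne - k).toNat : ℕ) : ℤ) = S.max' hne - k := Int.toNat_of_nonneg (by linarith)
    linarith
  let j := Nat.find hex
  have hj : (k : ℤ) + ((j : ℤ) + 1) ∉ S := Nat.find_spec hex
  have hrun : ∀ i : ℕ, i ≤ j → (k : ℤ) + (i : ℤ) ∈ S := by
    intro i hi
    rcases Nat.eq_zero_or_pos i with rfl | hpos
    · simpa using hk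
    · have := Nat.find_min hex (show i - 1 < j by omega)
      rw [not_not] at this
      have e1 : (((i - 1 : ℕ) : ℤ) + 1) = (i : ℤ) := by rw [Nat.cast_sub (by omega)]; push_cast; ring
      rwa [e1] at this
  set run : Finset ℤ := (Finset.range (j + 1)).image fun i : ℕ => (k : ℤ) + (i : ℤ) with hrundef
  have hrunS : run ⊆ S := by
    intro r hr
    obtain ⟨i, hi, rfl⟩ := Finset.mem_image.1 hr
    exact hrun i (by rw [Finset.mem_range] at hi; omega)
  have hβ'S : (k : ℤ) + ((j : ℤ) + 1) ∉ S \ run := fun h' => hj (Finset.mem_sdiff.1 h').1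
  have hval : val (insert ((k : ℤ) + ((j : ℤ) + 1)) (S \ run)) = ((n + 2 ^ k : ℕ) : ℚ) := by
    have e1 := val_insert hβ'S
    have e2 : val S = val (S \ run) + val run := val_eq_sdiff_add hrunS
    have e3 : val run = (2 : ℚ) ^ ((k : ℤ) + ((j : ℤ) + 1)) - (2 : ℚ) ^ (k : ℤ) := by
      rw [hrundef]; exact val_run k j
    have e4 : val S = n := val_natBits n
    push_cast
    rw [← zpow_natCast]
    linarith
  have heq : natBits (n + 2 ^ k) = insert ((k : ℤ) + ((j : ℤ) + 1)) (S \ run) := by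
    rw [← bitsOf_natCast, ← hval, bitsOf_val]
  rw [heq, Finset.card_insert_of_notMem hβ'S, Finset.card_sdiff_of_subset hrunS, hrundef,
    Finset.card_image_of_injective _ fun i i' h => by simpa using h, Finset.card_range]
  have : j + 1 ≤ S.card := by
    rw [← Finset.card_range (j + 1), ← Finset.card_image_of_injective (Finset.range (j + 1))
      (f := fun i : ℕ => (k : ℤ) + (i : ℤ)) fun i i' h => by simpa using h]
    exact Finset.card_le_card hrunS
  omega

/-- No-carry addition: disjoint expansions add up. -/
theorem val_union_of_disjoint {S T : Finset ℤ} (h : Disjoint S T) : val (S ∪ T) = val S + val T := by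
  unfold val; rw [Finset.sum_union h]

/-- `bits (n + n') = bits n ∪ bits n'` when the bits are disjoint. -/
theorem natBits_add_of_disjoint {n n' : ℕ} (h : Disjoint (natBits n) (natBits n')) :
    natBits (n + n') = natBits n ∪ natBits n' := by
  apply eq_of_val_eq
  rw [val_natBits, val_union_of_disjoint h, val_natBits, val_natBits]; push_cast; ring

/-! ## The partition end and the descent -/

section Descent

variable {q : ℕ}

/-- The half configuration `bits n ∪ {-1}` is routable for `n < 2^(q-1)`. -/
theorem routable_half (hq : 1 ≤ q) {n : ℕ} (hn : n < 2 ^ (q - 1)) : Routable q (insert (-1 : ℤ) (natBits n)) := by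
  have := (isQFloat_half hq hn).bitsOf.2.1
  rwa [bitsOf_half] at this

/-- THE PARTITION END: a top pair `(n + ½, m - n)` (`n < 2^(q-1)`) whose integer parts share no
bit IS a bit partition of `bits m ∪ {-1}`, so it is dominated by `BR_(a·b)(bits m)`. -/
theorem topPair_partition (hq : 1 ≤ q) (a b : SumTree) {m n : ℕ} (hm : 2 ^ (q - 1) ≤ m)
    (hm' : m < 2 ^ q) (hn : n < 2 ^ (q - 1)) (hnm : n ≤ m)
    (hdisj : Disjoint (natBits n) (natBits (m - n))) :
    (2 : ℚ) ^ ((q : ℤ) - 1) + treeBRv q a ((n : ℚ) + 1 / 2) + treeBRv q b ((m - n : ℕ) : ℚ) ≤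
      treeBR q (.node a b) (natBits m) := by
  have hne : (natBits m).Nonempty := ⟨_, pred_mem_natBits hq hm hm'⟩
  have htop := natBits_max' hq hm hm' hne
  have hunion : natBits m = natBits n ∪ natBits (m - n) := by
    rw [← natBits_add_of_disjoint hdisj]; congr 1; omega
  have hneg : (-1 : ℤ) ∉ natBits m := fun h => by have := natBits_nonneg h; omega
  have hι : (natBits m).max' hne - (q : ℤ) = -1 := by rw [htop]; ring
  -- the split (bits n ∪ {-1}, bits (m-n))
  have hmem : (insert (-1 : ℤ) (natBits n), natBits (m - n)) ∈
      splits q (natBits m) ((natBits m).max' hne) := by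
    refine mem_splits.2 ⟨Or.inr ⟨?_, ?_⟩, routable_half hq hn,
      natBits_routable (lt_of_le_of_lt (Nat.sub_le m n) hm')⟩
    · rw [hι]; exact Finset.insert_subset_insert _ (hunion ▸ Finset.subset_union_left)
    · show natBits (m - n) = insert ((natBits m).max' hne - (q : ℤ)) (natBits m) \ insert (-1 : ℤ) (natBits n)
      rw [hι, insert_sdiff_insert_of_notMem _ hneg, hunion, Finset.union_sdiff_left,
        Finset.sdiff_eq_self_of_disjoint hdisj.symm]
  have h := split_le_treeBRw_node (q := q) (W := fun e => (2 : ℚ) ^ e) (a := a) (b := b) hne hmem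
  rw [htop] at h
  rw [treeBRv, treeBRv, bitsOf_half, bitsOf_natCast, treeBR, treeBR, treeBR]
  linarith

/-- `(2:ℚ)^(q-1)` with a natural exponent is the zpow `2^((q:ℤ)-1)` (`q ≥ 1`). -/
theorem two_pow_pred {q : ℕ} (hq : 1 ≤ q) : (2 : ℚ) ^ (q - 1) = (2 : ℚ) ^ ((q : ℤ) - 1) := by
  rw [← zpow_natCast]; congr 1; push_cast [Nat.cast_sub hq]; ring

/-- A natural with two distinct set bits is at least their sum. -/
theorem add_pow_le_of_testBit {n i k : ℕ} (hi : n.testBit i = true) (hk : n.testBit k = true) (hik : i ≠ k) :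
    2 ^ i + 2 ^ k ≤ n := by
  have hi' : (i : ℤ) ∈ natBits n := natCast_mem_natBits.2 hi
  have hk' : (k : ℤ) ∈ (natBits n).erase i :=
    Finset.mem_erase.2 ⟨fun h => hik.symm (by exact_mod_cast h), natCast_mem_natBits.2 hk⟩
  have e1 := val_eq_add_erase hi'
  have e2 := val_eq_add_erase hk'
  have e3 := val_nonneg (((natBits n).erase i).erase k)
  rw [val_natBits] at e1
  rw [zpow_natCast] at e1 e2
  have : ((2 ^ i + 2 ^ k : ℕ) : ℚ) ≤ n := by push_cast; linarith
  exact_mod_cast this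

/-- A TOP PAIR IS GOOD: `2^(q-1) + BR_a(n + ½) + BR_b(m - n) ≤ BR_(a·b)(bits m)`. -/
def TopGood (q : ℕ) (a b : SumTree) (m n : ℕ) : Prop :=
  (2 : ℚ) ^ ((q : ℤ) - 1) + treeBRv q a ((n : ℚ) + 1 / 2) + treeBRv q b ((m - n : ℕ) : ℚ) ≤
    treeBR q (.node a b) (natBits m)

/-- THE DESCENT STEP: if all top pairs with fewer bits are good (both orientations), so is
`(n + ½ | m - n)` — partition end, or un-carry a common bit by (MC)² or by `TT`. -/
theorem topGood_step (hq : 2 ≤ q) (hTT : TT q) (a b : SumTree) {m : ℕ} (hm : 2 ^ (q - 1) ≤ m)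
    (hm' : m < 2 ^ q) {n : ℕ} (hn : n < 2 ^ (q - 1)) (hnm : n ≤ m)
    (ih : ∀ n' : ℕ, n' < 2 ^ (q - 1) → n' ≤ m →
      (natBits n').card + (natBits (m - n')).card < (natBits n).card + (natBits (m - n)).card →
      TopGood q a b m n' ∧ TopGood q b a m n') :
    TopGood q a b m n := by
  classical
  have hq1 : 1 ≤ q := le_trans (by norm_num) hq
  unfold TopGood
  by_cases hdisj : Disjoint (natBits n) (natBits (m - n))
  · exact topPair_partition hq1 a b hm hm' hn hnm hdisj
  · ---- a common bit k
    obtain ⟨k', hk'⟩ := Finset.not_disjoint_iff.1 hdisj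
    obtain ⟨hk'n, hk'e⟩ := hk'
    obtain ⟨k, hkn, hkk⟩ := mem_natBits.1 hk'n
    subst hkk
    have hke : (m - n).testBit k = true := natCast_mem_natBits.1 hk'e
    have h2n : 2 ^ k ≤ n := Nat.ge_two_pow_of_testBit hkn
    have h2e : 2 ^ k ≤ m - n := Nat.ge_two_pow_of_testBit hke
    have hkq : k + 2 ≤ q := by
      have := (natBits_lt hn hk'n).2
      have : k < q - 1 := by exact_mod_cast this
      omega
    -- arithmetic facts about the powers (atoms for `omega`)
    have hg0 : 0 < 2 ^ k := Nat.two_pow_pos k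
    have hd0 : 0 < 2 ^ (q - 1) := Nat.two_pow_pos _
    have hhalf : 2 ^ (q - 1) + 2 ^ (q - 1) = 2 ^ q := (two_pow_eq_half_add_half hq1).symm
    have hkle : 2 ^ k ≤ 2 ^ (q - 1) := Nat.pow_le_pow_right (by norm_num) (by omega)
    -- names for the values
    set H : ℚ := (2 : ℚ) ^ ((q : ℤ) - 1) with hH
    set β : ℚ := (2 : ℚ) ^ k with hβ
    have hβz : (2 : ℚ) ^ (k : ℤ) = β := zpow_natCast 2 k
    set o : ℚ := (n : ℚ) + 1 / 2 with ho
    set e : ℚ := ((m - n : ℕ) : ℚ) with hedef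
    have he : e = (m : ℚ) - n := by rw [hedef]; push_cast [Nat.cast_sub hnm]; ring
    -- bit counts of the moved states
    have hc1 : (natBits (n - 2 ^ k)).card + 1 = (natBits n).card := by
      rw [natBits_sub_pow hkn, Finset.card_erase_of_mem hk'n]
      have := Finset.card_pos.2 (⟨_, hk'n⟩ : (natBits n).Nonempty); omega
    have hc2 : (natBits (m - n - 2 ^ k)).card + 1 = (natBits (m - n)).card := by
      rw [natBits_sub_pow hke, Finset.card_erase_of_mem hk'e]
      have := Finset.card_pos.2 (⟨_, hk'e⟩ : (natBits (m - n)).Nonempty); omega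
    have hc3 : (natBits (n + 2 ^ k)).card ≤ (natBits n).card := card_natBits_add_pow_le hkn
    have hc4 : (natBits (m - n + 2 ^ k)).card ≤ (natBits (m - n)).card := card_natBits_add_pow_le hke
    -- the move M2 = (n - 2^k | m - n + 2^k), same orientation, is good by IH
    have hM2 : H + treeBRv q a (o - β) + treeBRv q b (e + β) ≤ treeBR q (.node a b) (natBits m) := by
      have h := (ih (n - 2 ^ k) (by omega) (by omega) (by
        rw [show m - (n - 2 ^ k) = m - n + 2 ^ k by omega]; omega)).1
      unfold TopGood at h
      have e1 : ((n - 2 ^ k : ℕ) : ℚ) + 1 / 2 = o - β := by rw [ho, hβ]; push_cast [Nat.cast_sub h2n]; ring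
      have e2 : ((m - (n - 2 ^ k) : ℕ) : ℚ) = e + β := by
        rw [he, hβ, show m - (n - 2 ^ k) = m - n + 2 ^ k by omega]; push_cast [Nat.cast_sub hnm]; ring
      rw [e1, e2] at h; exact h
    -- floats
    have hoF : IsQFloat q o := isQFloat_half hq1 hn
    have heF : IsQFloat q e := by
      rw [hedef]; exact isQFloat_natCast (le_trans Nat.one_le_two_pow h2e) (by omega)
    have hko : (k : ℤ) ∈ bitsOf o := by rw [ho, bitsOf_half]; exact Finset.mem_insert_of_mem hk'n
    have hke' : (k : ℤ) ∈ bitsOf e := by rw [hedef, bitsOf_natCast]; exact hk'e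
    have heβF : IsQFloat q (e + β) := by
      have : e + β = ((m - n + 2 ^ k : ℕ) : ℚ) := by rw [hedef, hβ]; push_cast; ring
      rw [this]; exact isQFloat_natCast (by omega) (by omega)
    -- MC at e (always available)
    have hMCe := treeBRv_midconvex b heF hke' (by rw [hβz]; exact heβF)
    rw [hβz] at hMCe
    by_cases hA : n + 2 ^ k < 2 ^ (q - 1)
    · ---- case o + β < σ: moves M1, M2 and (MC)²
      have hoβF : IsQFloat q (o + β) := by
        have : o + β = ((n + 2 ^ k : ℕ) : ℚ) + 1 / 2 := by rw [ho, hβ]; push_cast; ring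
        rw [this]; exact isQFloat_half hq1 hA
      have hMCo := treeBRv_midconvex a hoF hko (by rw [hβz]; exact hoβF)
      rw [hβz] at hMCo
      -- M1 = (n + 2^k | m - n - 2^k) is good by IH
      have hM1 : H + treeBRv q a (o + β) + treeBRv q b (e - β) ≤ treeBR q (.node a b) (natBits m) := by
        have h := (ih (n + 2 ^ k) hA (by omega) (by
          rw [show m - (n + 2 ^ k) = m - n - 2 ^ k by omega]; omega)).1
        unfold TopGood at h
        have e1 : ((n + 2 ^ k : ℕ) : ℚ) + 1 / 2 = o + β := by rw [ho, hβ]; push_cast; ring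
        have e2 : ((m - (n + 2 ^ k) : ℕ) : ℚ) = e - β := by
          rw [he, hβ]; push_cast [Nat.cast_sub (show n + 2 ^ k ≤ m by omega)]; ring
        rw [e1, e2] at h; exact h
      linarith
    · ---- case o + β ≥ σ: the leading bit is re-assembled; moves M1′, M2 and TT
      have hA' : 2 ^ (q - 1) ≤ n + 2 ^ k := not_lt.1 hA
      -- then e < σ
      have helt : m - n < 2 ^ (q - 1) := by
        by_contra hge
        have hge : 2 ^ (q - 1) ≤ m - n := not_lt.1 hge
        have htop : (m - n).testBit (q - 1) = true := by
          have := pred_mem_natBits hq1 hge (by omega : m - n < 2 ^ q)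
          have e1 : ((q : ℤ) - 1) = ((q - 1 : ℕ) : ℤ) := by push_cast [Nat.cast_sub hq1]; ring
          rw [e1] at this; exact natCast_mem_natBits.1 this
        have := add_pow_le_of_testBit htop hke (by omega)
        omega
      set A : ℕ := n - (2 ^ (q - 1) - 2 ^ k) with hAdef
      set B : ℕ := m - n - 2 ^ k with hBdef
      have hAlt : A < 2 ^ k := by omega
      have hBlt : B + 2 ^ k < 2 ^ (q - 1) := by omega
      have hBbit : B.testBit k = false := by
        have : (k : ℤ) ∉ natBits B := by
          rw [hBdef, natBits_sub_pow hke]; exact Finset.notMem_erase _ _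
        by_contra h'
        exact this (natCast_mem_natBits.2 (by simpa using h'))
      have hoTT : (2 : ℚ) ^ (q - 1) - β + A + 1 / 2 = o := by
        rw [ho, hAdef, hβ]
        push_cast [Nat.cast_sub (show 2 ^ (q - 1) - 2 ^ k ≤ n by omega), Nat.cast_sub hkle]
        ring
      have heTT : β + (B : ℚ) = e := by
        rw [he, hBdef, hβ]; push_cast [Nat.cast_sub h2e, Nat.cast_sub hnm]; ring
      have hT := hTT a b k A B hkq hAlt hBlt hBbit
      simp only at hT
      rw [← hβ, hoTT, heTT] at hT
      -- M1′ = (B odd on b | n + 2^k on a) is good by IH (second orientation)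
      have hM1' : H + treeBRv q b (e - β + 1 / 2) + treeBRv q a (o + β - 1 / 2) ≤
          treeBR q (.node a b) (natBits m) := by
        have hmB : m - B = n + 2 ^ k := by omega
        have h := (ih B (by omega) (by omega) (by rw [hmB]; omega)).2
        unfold TopGood at h
        have e1 : (B : ℚ) + 1 / 2 = e - β + 1 / 2 := by rw [← heTT]; ring
        have e2 : ((m - B : ℕ) : ℚ) = o + β - 1 / 2 := by rw [hmB, ho, hβ]; push_cast; ring
        have hcomm : treeBR q (.node b a) (natBits m) = treeBR q (.node a b) (natBits m) := by
          unfold treeBR; exact treeBRw_node_comm q _ b a _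
        rw [e1, e2, hcomm] at h
        exact h
      have hmax : max (treeBRv q a (o + β - 1 / 2) + treeBRv q b (e - β + 1 / 2))
          (treeBRv q a (o - β) + treeBRv q b (e + β)) ≤ treeBR q (.node a b) (natBits m) - H :=
        max_le (by linarith) (by linarith)
      linarith

/-- **THE DESCENT** (opt (UC-II′) under `TT`): every top pair is good, in both orientations. -/
theorem topGood_of_TT (hq : 2 ≤ q) (hTT : TT q) (a b : SumTree) {m : ℕ} (hm : 2 ^ (q - 1) ≤ m)
    (hm' : m < 2 ^ q) :
    ∀ (μ n : ℕ), n < 2 ^ (q - 1) → n ≤ m → (natBits n).card + (natBits (m - n)).card ≤ μ →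
      TopGood q a b m n ∧ TopGood q b a m n
  | 0, n, hn, hnm, hμ =>
      ⟨topGood_step hq hTT a b hm hm' hn hnm fun n' _ _ h => absurd h (by omega),
       topGood_step hq hTT b a hm hm' hn hnm fun n' _ _ h => absurd h (by omega)⟩
  | μ + 1, n, hn, hnm, hμ =>
      ⟨topGood_step hq hTT a b hm hm' hn hnm fun n' hn' hnm' h =>
          topGood_of_TT hq hTT a b hm hm' μ n' hn' hnm' (by omega),
       topGood_step hq hTT b a hm hm' hn hnm fun n' hn' hnm' h =>
          (topGood_of_TT hq hTT a b hm hm' μ n' hn' hnm' (by omega)).symm⟩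

/-- Every top pair is dominated by the best bit partition (`TT q`, `q ≥ 2`). -/
theorem topPair_le_of_TT (hq : 2 ≤ q) (hTT : TT q) (a b : SumTree) {m n : ℕ} (hm : 2 ^ (q - 1) ≤ m)
    (hm' : m < 2 ^ q) (hn : n < 2 ^ (q - 1)) (hnm : n ≤ m) :
    (2 : ℚ) ^ ((q : ℤ) - 1) + treeBRv q a ((n : ℚ) + 1 / 2) + treeBRv q b ((m - n : ℕ) : ℚ) ≤
      treeBR q (.node a b) (natBits m) :=
  (topGood_of_TT hq hTT a b hm hm' _ n hn hnm le_rfl).1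

end Descent

end Summit.Ventures.CertifiedArithmetic.LowPrec.Opt
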